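import Literature.NumberTheory.Sieve.MontgomeryVaughan1975Zeros
import Literature.NumberTheory.Sieve.MontgomeryVaughan1975Tools
import HarnessLib

/-!
# Montgomery–Vaughan (1975), §§4, 6, 7: the exceptional zero, the major-arc formulae, and
Gallagher's lemmas — objects and named facts

H. L. Montgomery, R. C. Vaughan, *The exceptional set in Goldbach's problem*, Acta Arith. 27
(1975) 353–370 [MontgomeryVaughanActa1975], read from the journal scan (pp. 356–368). This file
vendors the OUTPUT of §§4–7 — the major-arc formulae (6.17), (6.1͂7) with the error-term bounds
(7.1), (7.͂1) inserted, exactly as they are consumed in §8 (p. 367) — together with the two deep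
inputs of §4 (Gallagher's Lemma 1 and Theorem 7 = Lemmas 4.2, 4.3), as named facts, and defines
the objects they mention. The case analysis of §8 ((8.3) from these facts) is PROVED in
`MontgomeryVaughan1975Section8.lean` and `MontgomeryVaughan1975Section8Assembly.lean`; after it, the tree's fact
`Literature.NumberTheory.Sieve.MontgomeryVaughan1975.majorArc_lowerBound` ((8.3)), and with it
`Literature.NumberTheory.Sieve.goldbachExceptionalCount_isBigO_rpow` (parity.S15, M–V Theorem 1),
rest on `majorArc_formulae` alone.

## The paper's §§4, 6, 7 (journal pages)

* LEMMA 4.1 (p. 356–357, "established by Davenport §14"): there is `c₁ > 0` such that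
  `L(σ, χ) ≠ 0` for real `σ ≥ 1 − c₁/log P` and every primitive `χ` mod `q ≤ P`, with the possible
  exception of at most one primitive `χ̃` (mod `r̃`); if it exists, `χ̃` is quadratic and its unique
  exceptional real zero `β̃` satisfies (4.1) `c₂ r̃^{-1/2} log⁻² r̃ ≤ 1 − β̃ ≤ c₁/log P`.
  (`IsExceptionalZero`, `Lemma41At`; the tree PROVES Page's theorem in this currency,
  `exists_exceptionalZero_unique`, and Siegel's bound `…Siegel.exists_one_sub_realZero_ge`.)
* LEMMA 4.2 (p. 357) = Gallagher, Invent. Math. 11 (1970), Lemma 1 (`lemma42_gallagher`).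
* LEMMA 4.3 (p. 357–358) = Gallagher 1970, Theorem 7 with `max max` and `T = P⁶`
  (`lemma43_gallagher`), (4.2).
* §6 (pp. 361–366): `T(η) = ∑_{P<n≤X} e(nη)`, `T̃(η) = −∑_{P<n≤X} n^{β̃−1} e(nη)` (`linSum`,
  `excLinSum`), `Ĩ(n) = ∫₀¹ T̃(η)² e(−nη) dη = ∑_{P<k<n−P} (k(n−k))^{β̃−1}` (`excPairSum`, p. 364 and
  p. 365), the singular series (6.16) `𝔖(n) = ∑_q μ(q)²φ(q)⁻²c_q(−n) = ∏_{p∤n}(1 − (p−1)⁻²)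
  ∏_{p∣n}(1 + (p−1)⁻¹)` (= the tree's `goldbachSingularSeries n`, the evaluated form
  `2C₂∏_{p∣n,p>2}(p−1)/(p−2)` for even `n`, `0` for odd `n`), the exceptional series (6.1͂6)
  `𝔖̃(n) = ∑_{r̃∣q} τ(χ̃χ₀)²c_q(−n)φ(q)⁻² = χ̃(−1) μ(r̃/(r̃,n)) r̃ φ(r̃)⁻¹ φ(r̃/(r̃,n))⁻¹ ∏_{p∤r̃,p∤n}(1 −
  (p−1)⁻²) ∏_{p∤r̃,p∣n}(1 + (p−1)⁻¹)`, the formulae (6.17) `R₁(n) = 𝔖(n)n + O(X^{1+δ}P⁻¹) +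
  O(nφ(n)⁻¹(WX^{1/2} + W²))` (no exceptional character) and (6.1͂7) `R₁(n) = 𝔖(n)n + 𝔖̃(n)Ĩ(n) +
  O(χ̃(n)²r̃nX/(φ(r̃)²φ(n))) + O(X^{1+δ}P⁻¹(n,r̃)) + O(nφ(n)⁻¹(X^{1/2}W + W²))` (`n ≤ X`), and (6.21).
* §7 (p. 366): (7.1) `W ≪ X^{1/2} exp(−c₆ log X/log P)`, (7.͂1) `W ≪ X^{1/2}(1−β̃) exp(−c₆ log X/
  log P) log P` (from Lemmas 4.2, 4.3).

## Design choices

* `𝔖̃(n)` enters the vendored (6.1͂7) through the finite ratio `excRatio χ̃ n = 𝔖̃(n)/𝔖(n)`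
  (`χ̃(−1) μ(r̃/(r̃,n)) r̃ φ(r̃)⁻¹ φ(r̃/(r̃,n))⁻¹ / ∏_{p∣r̃} (local factor of (6.16) at p)`): for EVEN
  `n` the Euler products in (6.16) and (6.1͂6) differ exactly by the finitely many factors at
  `p ∣ r̃`, none of which vanishes, so `𝔖̃(n) = excRatio χ̃ n · 𝔖(n)`; (6.1͂7) is recorded for even
  `n ≤ X` (the only `n` used in §8) in this form. For odd `n` and even `r̃` the ratio is the junk
  value `0` (a factor `1 − (2−1)⁻²` vanishes) and nothing is claimed.
* (7.1)/(7.͂1) are inserted into (6.17)/(6.1͂7), as M–V themselves do in §8 ("from (6.17) and (7.1)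
  it follows that `R₁(n) = 𝔖(n)n + O(nφ(n)⁻¹X exp(−c₇δ⁻¹))`"); `exp(−c₆ log X/log P) = exp(−c₆/(6δ))`
  is written `exp(−c₆/δ)`.
* The dichotomy "the exceptional character does (not) occur" is relative to Lemma 4.1's `c₁` at
  level `P = X^{6δ}`; the property of `c₁` asserted by Lemma 4.1 (quadraticity and uniqueness of an
  exceptional zero) is part of the vendored fact (`Lemma41At`).

## References

* H. L. Montgomery, R. C. Vaughan, Acta Arith. 27 (1975) 353–370 [MontgomeryVaughanActa1975].
* P. X. Gallagher, *A large sieve density estimate near σ = 1*, Invent. Math. 11 (1970) 329–339,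
  Lemma 1 and Theorem 7 [Gallagher1970].
* J. Brüdern, A. Perelli, Ann. Inst. Fourier 48 (1998), §4 Lemmas 2–3 (the same two formulae,
  "(6.17) of Montgomery & Vaughan … followed by an appeal to their (7.1)") [BrudernPerelli1998].
-/

noncomputable section

open Finset MeasureTheory Filter
open scoped FourierTransform ArithmeticFunction.Moebius

namespace Literature.NumberTheory.Sieve.MontgomeryVaughan1975

/-! ### §4: the exceptional zero (Lemma 4.1) -/

/-- **The exceptional zero of Lemma 4.1** (Montgomery–Vaughan 1975, p. 356–357), relative to the
constant `c₁` and the level `P`: `β` is a real zero of `L(s, χ)`, `χ` a primitive non-principal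
character mod `r ≤ P`, in the interval `1 − c₁/log P ≤ β < 1` ((4.1), right-hand inequality).
(`β < 1` is automatic, `L(1, χ) ≠ 0`, and is recorded for convenience; the principal character
mod `1`, formally primitive, is excluded — `ζ(σ) < 0` for `0 < σ < 1` has no exceptional zero.)
[cite: MontgomeryVaughanActa1975, §4 Lemma 4.1] -/
def IsExceptionalZero (c₁ P : ℝ) (r : ℕ) [NeZero r] (χ : DirichletCharacter ℂ r) (β : ℝ) : Prop :=
  χ.IsPrimitive ∧ χ ≠ 1 ∧ (r : ℝ) ≤ P ∧ 1 - c₁ / Real.log P ≤ β ∧ β < 1 ∧ χ.LFunction β = 0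

/-- **LEMMA 4.1 as a property of `c₁` at level `P`** (Montgomery–Vaughan 1975, p. 356–357: "with
the possible exception of at most one primitive character `χ̃` (mod `r̃`). If it exists, the
character `χ̃` is quadratic, and the (unique) exceptional real zero `β̃` …"): every exceptional zero
belongs to a quadratic character, and any two exceptional data `(r₁, χ₁, β₁)`, `(r₂, χ₂, β₂)`
coincide. For `c₁` below an absolute constant this is Page's theorem, PROVED in the tree as
`exists_exceptionalZero_unique` (MNT I Cor. 11.10). [cite: MontgomeryVaughanActa1975, §4 Lemma 4.1] -/
def Lemma41At (c₁ P : ℝ) : Prop :=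
  (∀ (r : ℕ) [NeZero r] (χ : DirichletCharacter ℂ r) (β : ℝ),
      IsExceptionalZero c₁ P r χ β → χ ^ 2 = 1) ∧
  (∀ (r₁ r₂ : ℕ) [NeZero r₁] [NeZero r₂] (χ₁ : DirichletCharacter ℂ r₁)
      (χ₂ : DirichletCharacter ℂ r₂) (β₁ β₂ : ℝ),
      IsExceptionalZero c₁ P r₁ χ₁ β₁ → IsExceptionalZero c₁ P r₂ χ₂ β₂ →
        r₁ = r₂ ∧ β₁ = β₂ ∧ ∀ n : ℕ, χ₁ (n : ZMod r₁) = χ₂ (n : ZMod r₂))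

/-! ### §4: Gallagher's lemmas (Lemmas 4.2 and 4.3) -/

/-- NAMED FACT — **LEMMA 4.2 = Gallagher's Lemma 1** (Montgomery–Vaughan 1975, p. 357: "The
following is Lemma 1 of Gallagher [5]"; Gallagher, Invent. Math. 11 (1970), Lemma 1): for arbitrary
real `u₁, …, u_N` and any `ϰ > 0`,
`∫_{−ϰ}^{ϰ} |∑_{n≤N} u_n e(nη)|² dη ≪ ∫_{−∞}^{+∞} |ϰ ∑_{x ≤ n ≤ x+(2ϰ)⁻¹} u_n|² dx`
(absolute implied constant; the inner sum is over the integers `1 ≤ n ≤ N` of `[x, x + (2ϰ)⁻¹]`).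
Not in Mathlib. [cite: Gallagher1970, Lemma 1] -/
def lemma42_gallagher : Prop :=
  ∃ C : ℝ, ∀ (N : ℕ) (u : ℕ → ℝ) (ϰ : ℝ), 0 < ϰ →
    ∫ η in (-ϰ)..ϰ, ‖∑ n ∈ Icc 1 N, (u n : ℂ) * (𝐞 (n * η) : ℂ)‖ ^ 2 ≤
      C * ∫ x : ℝ, (ϰ * ∑ n ∈ (Icc 1 N).filter (fun n : ℕ => x ≤ (n : ℝ) ∧ (n : ℝ) ≤ x + (2 * ϰ)⁻¹), u n) ^ 2

/-- The sum `∑_{x−h < p ≤ x} χ(p) log p` over primes of Lemma 4.3 (Montgomery–Vaughan 1975, (4.2)),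
for natural `x, h` (for `h ≥ x` all primes `p ≤ x` are counted).
[cite: MontgomeryVaughanActa1975, §4 Lemma 4.3 (4.2)] -/
def charPrimeSum {q : ℕ} (χ : DirichletCharacter ℂ q) (x h : ℕ) : ℂ :=
  ∑ p ∈ (Ioc (x - h) x).filter Nat.Prime, χ (p : ZMod q) * (Real.log p : ℂ)

/-- The term `∑#` of Lemma 4.3 when there is no exceptional character: for `q = 1` the sum over
primes is diminished by `∑_{x−h<n≤x, n>0} 1` (Montgomery–Vaughan 1975, p. 357).
[cite: MontgomeryVaughanActa1975, §4 Lemma 4.3 (4.2)] -/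
def gallagherTerm {q : ℕ} (χ : DirichletCharacter ℂ q) (x h : ℕ) : ℂ :=
  charPrimeSum χ x h - if q = 1 then ((Ioc (x - h) x).card : ℂ) else 0

open scoped Classical in
/-- The term `∑#` of Lemma 4.3 in the presence of the exceptional character `χ̃` (mod `r̃`) with
zero `β̃`: in addition, the term of `χ̃` itself is augmented by `∑_{x−h<n≤x, n>0} n^{β̃−1}`
(Montgomery–Vaughan 1975, p. 357). [cite: MontgomeryVaughanActa1975, §4 Lemma 4.3 (4.2)] -/
def gallagherTermExc {r : ℕ} (χe : DirichletCharacter ℂ r) (β : ℝ) {q : ℕ}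
    (χ : DirichletCharacter ℂ q) (x h : ℕ) : ℂ :=
  gallagherTerm χ x h +
    if q = r ∧ ∀ n : ℕ, χ (n : ZMod q) = χe (n : ZMod r) then
      ((∑ n ∈ Ioc (x - h) x, (n : ℝ) ^ (β - 1) : ℝ) : ℂ) else 0

open scoped Classical in
/-- NAMED FACT — **LEMMA 4.3 = Gallagher's Theorem 7, modified** (Montgomery–Vaughan 1975,
pp. 357–358, (4.2)): for suitable (small) positive absolute constants `c₃, c₄` (and the constant
`c₁` of Lemma 4.1 delineating the exceptional character at level `P`),
`∑_{q≤P} ∑*_χ max_{x≤N} max_{h≤N} (h + N/P)⁻¹ |∑#_{x−h<p≤x} χ(p) log p| ≪ exp(−c₃ log N/log P)`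
provided `exp(log^{1/2} N) ≤ P ≤ N^{c₄}`, where `∑#` means: the term with `q = 1` is
`∑ log p − ∑_{x−h<n≤x,n>0} 1`, and if there is an exceptional character `χ̃` its term is
`∑ χ̃(p) log p + ∑_{x−h<n≤x,n>0} n^{β̃−1}`; and "if the exceptional character occurs then the right
hand side of (4.2) may be reduced by a factor of `(1 − β̃) log P`". ("This is Theorem 7 of
Gallagher [5], with two modifications": the `max max`, and `T = P⁶` with the effective (4.1) in
place of Siegel's theorem.) The maxima are realised junk-free by arbitrary choice functions
`x, h ≤ N`. Not in Mathlib; the deep input (log-free zero-density estimates, Turán's method, the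
Deuring–Heilbronn phenomenon). [cite: MontgomeryVaughanActa1975, §4 Lemma 4.3 (4.2)]
[cite: Gallagher1970, Theorem 7] -/
def lemma43_gallagher : Prop :=
  ∃ c₁ : ℝ, 0 < c₁ ∧ ∃ c₃ : ℝ, 0 < c₃ ∧ ∃ c₄ : ℝ, 0 < c₄ ∧ ∃ C : ℝ,
    ∀ (N : ℕ) (P : ℝ), Real.exp (Real.sqrt (Real.log N)) ≤ P → P ≤ (N : ℝ) ^ c₄ →
      ∀ (x h : (q : ℕ) → DirichletCharacter ℂ q → ℕ),
        (∀ q χ, x q χ ≤ N) → (∀ q χ, h q χ ≤ N) →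
        ((∀ (r : ℕ) [NeZero r] (χ : DirichletCharacter ℂ r) (β : ℝ), ¬ IsExceptionalZero c₁ P r χ β) →
          ∑ q ∈ Icc 1 ⌊P⌋₊, ∑ χ : DirichletCharacter ℂ q with χ.IsPrimitive,
              ((h q χ : ℝ) + N / P)⁻¹ * ‖gallagherTerm χ (x q χ) (h q χ)‖ ≤
            C * Real.exp (-c₃ * Real.log N / Real.log P)) ∧
        (∀ (r : ℕ) [NeZero r] (χe : DirichletCharacter ℂ r) (β : ℝ), IsExceptionalZero c₁ P r χe β →
          ∑ q ∈ Icc 1 ⌊P⌋₊, ∑ χ : DirichletCharacter ℂ q with χ.IsPrimitive,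
              ((h q χ : ℝ) + N / P)⁻¹ * ‖gallagherTermExc χe β χ (x q χ) (h q χ)‖ ≤
            C * ((1 - β) * Real.log P) * Real.exp (-c₃ * Real.log N / Real.log P))

/-! ### §6: the objects of the major-arc formulae -/

/-- The integers `P < k ≤ X` of the window of `T`, `T̃` (Montgomery–Vaughan 1975, p. 361).
[cite: MontgomeryVaughanActa1975, §6 (6.1)] -/
def intWindow (P X : ℝ) : Finset ℕ :=
  (Icc 1 ⌊X⌋₊).filter fun k => P < k

/-- `T(η) = ∑_{P<n≤X} e(nη)` (Montgomery–Vaughan 1975, p. 361).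
[cite: MontgomeryVaughanActa1975, §6 (6.2)] -/
def linSum (P X η : ℝ) : ℂ :=
  ∑ k ∈ intWindow P X, (𝐞 (k * η) : ℂ)

/-- `T̃(η) = −∑_{P<n≤X} n^{β̃−1} e(nη)` ("defined only if there is an exceptional zero `β̃`";
here for any real parameter `β`) (Montgomery–Vaughan 1975, p. 361).
[cite: MontgomeryVaughanActa1975, §6 (6.2)] -/
def excLinSum (P X β η : ℝ) : ℂ :=
  -∑ k ∈ intWindow P X, (((k : ℝ) ^ (β - 1) : ℝ) : ℂ) * (𝐞 (k * η) : ℂ)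

/-- `Ĩ(n) = ∫₀¹ T̃(η)² e(−nη) dη = ∑∑_{P<k,k'≤X, k+k'=n} (k k')^{β̃−1}` (Montgomery–Vaughan 1975,
p. 364 (definition as the integral) and p. 365 ("Clearly `Ĩ(n) = ∑_{P<k<n−P} (k(n−k))^{β̃−1}`");
the two agree by orthogonality, `excPairSum_eq_integral`). Defined by the finite double sum.
[cite: MontgomeryVaughanActa1975, §6 (6.18)] -/
def excPairSum (P X β : ℝ) (n : ℕ) : ℝ :=
  ∑ k ∈ intWindow P X, ∑ k' ∈ intWindow P X, if k + k' = n then ((k : ℝ) * k') ^ (β - 1) else 0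

/-- The local factor at the prime `p` of the singular series (6.16):
`1 + 1/(p−1)` if `p ∣ n`, `1 − 1/(p−1)²` if `p ∤ n` (Montgomery–Vaughan 1975, (6.16), p. 363).
[cite: MontgomeryVaughanActa1975, §6 (6.16)] -/
def singSeriesLocalFactor (n p : ℕ) : ℝ :=
  if p ∣ n then 1 + 1 / ((p : ℝ) - 1) else 1 - 1 / ((p : ℝ) - 1) ^ 2

/-- **The ratio `𝔖̃(n)/𝔖(n)`** of the exceptional series (6.1͂6) (p. 365:
`𝔖̃(n) = χ̃(−1) μ(r̃/(r̃,n)) r̃ φ(r̃)⁻¹ φ(r̃/(r̃,n))⁻¹ ∏_{p∤r̃,p∤n}(1 − (p−1)⁻²) ∏_{p∤r̃,p∣n}(1 + (p−1)⁻¹)`)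
to the singular series (6.16) (`𝔖(n) = ∏_{p∤n}(1 − (p−1)⁻²) ∏_{p∣n}(1 + (p−1)⁻¹)`): the two Euler
products differ by the factors at `p ∣ r̃`, so for even `n` (no vanishing factor)
`𝔖̃(n) = excRatio χ̃ n · 𝔖(n)` with
`excRatio χ̃ n = χ̃(−1) μ(r̃/(r̃,n)) r̃ φ(r̃)⁻¹ φ(r̃/(r̃,n))⁻¹ / ∏_{p∣r̃} (local factor at p)`.
For odd `n` and even `r̃` this is the junk value `0` (Lean's `x/0 = 0`), a case never used.
[cite: MontgomeryVaughanActa1975, §6 (6.16) and (6.20), p. 365] -/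
def excRatio {r : ℕ} (χ : DirichletCharacter ℂ r) (n : ℕ) : ℝ :=
  (χ (-1)).re * (μ (r / Nat.gcd r n) : ℝ) *
    ((r : ℝ) / ((Nat.totient r : ℝ) * (Nat.totient (r / Nat.gcd r n) : ℝ))) /
    ∏ p ∈ r.primeFactors, singSeriesLocalFactor n p

/-! ### The major-arc formulae (6.17), (6.1͂7) with (7.1), (7.͂1): the named fact -/

/-- NAMED FACT — **the major-arc formulae of Montgomery–Vaughan 1975** ((6.17) p. 363 and (6.1͂7)
p. 365, with the error-term bounds (7.1), (7.͂1) p. 366 inserted, under the convention of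
Lemma 4.1 p. 356–357; `P = X^{6δ}`, `Q = X^{1−6δ}` (2.4), `R₁(n) = ∫_𝔐 S(α)² e(−nα) dα` (3.1),
`0 < δ ≤ δ₀`, `X ≥ X₀(δ)`, all constants absolute). There are `c₁, c₆, C, δ₀ > 0` such that for
`0 < δ ≤ δ₀` and `X ≥ X₀(δ)`:
(o) `c₁` delineates the exceptional character at level `P` as in Lemma 4.1 (`Lemma41At`);
(i) if the exceptional character does not occur, then for `1 ≤ n ≤ X`
  `|R₁(n) − 𝔖(n) n| ≤ C (X^{1+δ}P⁻¹ + (n/φ(n)) X e^{−c₆/δ})`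
  ((6.17) `R₁(n) = 𝔖(n)n + O(X^{1+δ}P⁻¹) + O(nφ(n)⁻¹(WX^{1/2} + W²))` with (7.1)
  `W ≪ X^{1/2} exp(−c₆ log X/log P)`, `log X/log P = (6δ)⁻¹`);
(ii) if `(r̃, χ̃, β̃)` is exceptional, then for even `1 ≤ n ≤ X`
  `|R₁(n) − 𝔖(n)(n + (𝔖̃(n)/𝔖(n)) Ĩ(n))| ≤ C (𝟙_{(n,r̃)=1} r̃ n X/(φ(r̃)²φ(n)) + X^{1+δ}P⁻¹ (n,r̃)
   + (n/φ(n)) X (1−β̃)(log P) e^{−c₆/δ})`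
  ((6.1͂7) `R₁(n) = 𝔖(n)n + 𝔖̃(n)Ĩ(n) + O(χ̃(n)² r̃ n X/(φ(r̃)²φ(n))) + O(X^{1+δ}P⁻¹(n,r̃)) +
  O(nφ(n)⁻¹(X^{1/2}W + W²))` with (7.͂1) `W ≪ X^{1/2}(1 − β̃) exp(−c₆ log X/log P) log P`; here
  `χ̃(n)² = 𝟙_{(n,r̃)=1}`, `𝔖̃(n)/𝔖(n) = excRatio χ̃ n` for even `n`, `Ĩ = excPairSum`).
`𝔖(n)` is the singular series (6.16), i.e. the tree's `goldbachSingularSeries n`. This is the output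
of §§4–7 of the paper (Lemmas 4.1–4.3, 5.1–5.5, (6.1)–(6.21), (7.1)); §8 deduces (8.3)
(`majorArc_lowerBound`) from it (`MontgomeryVaughan1975Section8.lean` and `MontgomeryVaughan1975Section8Assembly.lean`). Restated in print as
Brüdern–Perelli 1998, §4, Lemmas 2 and 3. Not in Mathlib.
[cite: MontgomeryVaughanActa1975, §6 (6.17), (6.17~) and §7 (7.1), (7.1~)] -/
def majorArc_formulae : Prop :=
  ∃ c₁ : ℝ, 0 < c₁ ∧ ∃ c₆ : ℝ, 0 < c₆ ∧ ∃ C : ℝ, 0 < C ∧ ∃ δ₀ : ℝ, 0 < δ₀ ∧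
    ∀ δ : ℝ, 0 < δ → δ ≤ δ₀ → ∃ X₀ : ℝ, ∀ X : ℝ, X₀ ≤ X →
      Lemma41At c₁ (X ^ (6 * δ)) ∧
      ((∀ (r : ℕ) [NeZero r] (χ : DirichletCharacter ℂ r) (β : ℝ),
            ¬ IsExceptionalZero c₁ (X ^ (6 * δ)) r χ β) →
        ∀ n : ℕ, 1 ≤ n → (n : ℝ) ≤ X →
          ‖majorArcIntegral (X ^ (6 * δ)) (X ^ (1 - 6 * δ)) X n -
              ((goldbachSingularSeries n * n : ℝ) : ℂ)‖ ≤
            C * (X ^ (1 + δ) * (X ^ (6 * δ))⁻¹ +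
              (n : ℝ) / (Nat.totient n : ℝ) * X * Real.exp (-(c₆ / δ)))) ∧
      (∀ (r : ℕ) [NeZero r] (χ : DirichletCharacter ℂ r) (β : ℝ),
          IsExceptionalZero c₁ (X ^ (6 * δ)) r χ β →
        ∀ n : ℕ, 1 ≤ n → (n : ℝ) ≤ X → Even n →
          ‖majorArcIntegral (X ^ (6 * δ)) (X ^ (1 - 6 * δ)) X n -
              ((goldbachSingularSeries n *
                  (n + excRatio χ n * excPairSum (X ^ (6 * δ)) X β n) : ℝ) : ℂ)‖ ≤
            C * ((if n.Coprime r then (r : ℝ) * n * X / ((Nat.totient r : ℝ) ^ 2 * Nat.totient n)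
                  else 0) +
              X ^ (1 + δ) * (X ^ (6 * δ))⁻¹ * Nat.gcd n r +
              (n : ℝ) / (Nat.totient n : ℝ) * X * ((1 - β) * Real.log (X ^ (6 * δ))) *
                Real.exp (-(c₆ / δ))))


/-! ### Proved API: the definitions above are the paper's objects -/

/-- Membership in the window `P < k ≤ X`. [folklore] -/
theorem mem_intWindow {P X : ℝ} {k : ℕ} : k ∈ intWindow P X ↔ (1 ≤ k ∧ k ≤ ⌊X⌋₊) ∧ P < k := by
  rw [intWindow, Finset.mem_filter, Finset.mem_Icc]

/-- The window has at most `X` elements. [folklore] -/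
theorem card_intWindow_le {P X : ℝ} (hX : 0 ≤ X) : ((intWindow P X).card : ℝ) ≤ X := by
  calc ((intWindow P X).card : ℝ) ≤ ((Icc 1 ⌊X⌋₊).card : ℝ) := by
        exact_mod_cast Finset.card_filter_le _ _
    _ = ⌊X⌋₊ := by rw [Nat.card_Icc]; push_cast; ring
    _ ≤ X := Nat.floor_le hX

/-- `Ĩ(n) ≥ 0`. [folklore] -/
theorem excPairSum_nonneg (P X β : ℝ) (n : ℕ) : 0 ≤ excPairSum P X β n := by
  refine Finset.sum_nonneg fun k _ => Finset.sum_nonneg fun k' _ => ?_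
  split_ifs
  · positivity
  · exact le_rfl

/-- **`Ĩ(n)` is the integral `∫₀¹ T̃(η)² e(−nη) dη`** (its definition in Montgomery–Vaughan 1975,
p. 364), by orthogonality. [cite: MontgomeryVaughanActa1975, §6 (6.18)] -/
theorem excPairSum_eq_integral (P X β : ℝ) (n : ℕ) :
    ∫ η in (0 : ℝ)..0 + 1, excLinSum P X β η ^ 2 * (𝐞 (-(n * η)) : ℂ) = (excPairSum P X β n : ℂ) := by
  have h := integral_trigPoly_mul_trigPoly (intWindow P X) (intWindow P X)
    (fun k => (((k : ℝ) ^ (β - 1) : ℝ) : ℂ)) (fun k => (((k : ℝ) ^ (β - 1) : ℝ) : ℂ)) 0 n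
  have hsq : ∀ η : ℝ, excLinSum P X β η ^ 2 =
      (∑ k ∈ intWindow P X, (((k : ℝ) ^ (β - 1) : ℝ) : ℂ) * (𝐞 (k * η) : ℂ)) *
        (∑ k ∈ intWindow P X, (((k : ℝ) ^ (β - 1) : ℝ) : ℂ) * (𝐞 (k * η) : ℂ)) := by
    intro η; rw [excLinSum, neg_sq, sq]
  simp_rw [hsq]
  rw [h, excPairSum]
  push_cast
  refine Finset.sum_congr rfl fun k₁ hk₁ => Finset.sum_congr rfl fun k₂ hk₂ => ?_
  split_ifs
  · have h1 : (0 : ℝ) ≤ k₁ := Nat.cast_nonneg k₁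
    have h2 : (0 : ℝ) ≤ k₂ := Nat.cast_nonneg k₂
    rw [Real.mul_rpow h1 h2]; push_cast; ring
  · rfl

/-- **LEMMA 4.1 holds for every sufficiently small `c₁`** (Page's theorem, the tree's
`exists_exceptionalZero_unique`, MNT I Cor. 11.10): there is `c > 0` such that `Lemma41At c₁ P` for
all `0 < c₁ < c` and `P ≥ 4`. This discharges conjunct (o) of `majorArc_formulae` for small `c₁`.
[cite: MontgomeryVaughan2007, Corollary 11.10] -/
theorem lemma41At_of_lt : ∃ c : ℝ, 0 < c ∧ ∀ c₁ P : ℝ, 0 < c₁ → c₁ < c → 4 ≤ P → Lemma41At c₁ P := by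
  obtain ⟨c, hc, hPage⟩ := exists_exceptionalZero_unique
  refine ⟨c, hc, fun c₁ P hc₁ hc₁c hP => ?_⟩
  obtain ⟨hZ, hU⟩ := hPage P hP
  have hlog : 0 < Real.log P := Real.log_pos (by linarith)
  have hthr : ∀ β : ℝ, 1 - c₁ / Real.log P ≤ β → 1 - c / Real.log P < β := fun β hβ => by
    have : c₁ / Real.log P < c / Real.log P := div_lt_div_of_pos_right hc₁c hlog
    linarith
  refine ⟨fun r _ χ β hEZ => ?_, fun r₁ r₂ _ _ χ₁ χ₂ β₁ β₂ h₁ h₂ => ?_⟩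
  · obtain ⟨_, hne, hrP, hβlo, _, hzero⟩ := hEZ
    have h := hZ r χ hne hrP (β : ℂ) (by exact_mod_cast hzero) (by simp; linarith)
      (by simpa using hthr β hβlo)
    exact h.1
  · obtain ⟨hp₁, hne₁, hr₁, hβ₁, _, hz₁⟩ := h₁
    obtain ⟨hp₂, hne₂, hr₂, hβ₂, _, hz₂⟩ := h₂
    have hq₁ : χ₁ ^ 2 = 1 :=
      (hZ r₁ χ₁ hne₁ hr₁ (β₁ : ℂ) (by exact_mod_cast hz₁) (by simp; linarith) (by simpa using hthr β₁ hβ₁)).1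
    have hq₂ : χ₂ ^ 2 = 1 :=
      (hZ r₂ χ₂ hne₂ hr₂ (β₂ : ℂ) (by exact_mod_cast hz₂) (by simp; linarith) (by simpa using hthr β₂ hβ₂)).1
    exact hU r₁ r₂ χ₁ χ₂ hne₁ hne₂ hp₁ hp₂ hq₁ hq₂ hr₁ hr₂ β₁ β₂ hz₁ hz₂ (hthr β₁ hβ₁) (hthr β₂ hβ₂)

end Literature.NumberTheory.Sieve.MontgomeryVaughan1975
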